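import Summits.MatrixMultiplication.MatrixMultiplication.Theses.FourierTwoFamiliesModP
import Literature.Computability.AlgebraicComplexity.SimultaneousDoubleProduct

/-!
# `PrimeTwoFamilies` (crux stmt-MatrixMultiplication-14308, route FourierTwoFamiliesModP):
# `δ`-slices and tightness of the slack

Negative-side support file of the crux disprover (cdisprove seat); everything `sorry`-free.  The crux
is CKSU 2005 Conj. 4.7 ("two families") with prime cyclic hosts, an open conjecture in print; nothing
here settles it.  Companion files: `Shapes` (shape diversity / pattern poverty of witnesses),
`Translates` (the design baseline `δ > 1/2`), `ClauseDrops` (load-bearing clauses), `ValTransfer`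
(checked kill criteria via Pratt's `Val`).

* `PrimeTwoFamiliesAt δ` / `primeTwoFamilies_iff` — the crux is `∀ δ > 0, PrimeTwoFamiliesAt δ`
  (`Iff.rfl`); `PrimeTwoFamiliesAt.mono`; `primeTwoFamiliesAt_two` (the far slice holds trivially by
  singletons: the content is the limit `δ → 0`).
* `not_primeTwoFamiliesAt_zero` — TIGHTNESS of the slack: the exact slice `δ = 0` is false
  ((W) ⇒ `|Aᵢ||Bᵢ| ≤ p`, so `p = n²` would be a prime square).
-/

namespace Summit.MatrixMultiplication.MatrixMultiplication.Theorems.PrimeTwoFamilies.Negative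

open Finset
open Summit.MatrixMultiplication.MatrixMultiplication.Theses
open Literature.Computability.AlgebraicComplexity

/-! ## §0 The `δ`-slices of the crux -/

/-- The `δ`-slice of the crux `PrimeTwoFamilies` (the crux is `∀ δ > 0, PrimeTwoFamiliesAt δ`,
`primeTwoFamilies_iff`): arbitrarily large `n`, a prime `p ≤ n^{2+δ}` and `n` SDPP pairs in `ℤ/p`
with `|A_i||B_i| ≥ n^{2-δ}`.  In CKSU's `(α, β)`-language (arXiv:math/0511460 p. 8) a witness is a
design with `α ≥ 2 - δ` and `β ≤ 2 + δ`. -/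
def PrimeTwoFamiliesAt (δ : ℝ) : Prop :=
  ∀ n₀ : ℕ, ∃ n ≥ n₀, ∃ p : ℕ, p.Prime ∧ ∃ A B : Fin n → Finset (ZMod p),
    (∀ i : Fin n, ∀ a ∈ A i, ∀ a' ∈ A i, ∀ b ∈ B i, ∀ b' ∈ B i,
        (a - a') + (b - b') = 0 → a = a' ∧ b = b') ∧
    (∀ i j k : Fin n, ∀ a ∈ A i, ∀ a' ∈ A j, ∀ b ∈ B j, ∀ b' ∈ B k,
        (a - a') + (b - b') = 0 → i = k) ∧
    (p : ℝ) ≤ (n : ℝ) ^ (2 + δ) ∧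
    ∀ i : Fin n, (n : ℝ) ^ (2 - δ) ≤ (((A i).card * (B i).card : ℕ) : ℝ)

/-- The crux is the conjunction of its positive slices (definitional). -/
theorem primeTwoFamilies_iff :
    FourierTwoFamiliesModP.PrimeTwoFamilies ↔ ∀ δ : ℝ, 0 < δ → PrimeTwoFamiliesAt δ :=
  Iff.rfl

/-- Slices are monotone in `δ`. -/
theorem PrimeTwoFamiliesAt.mono {δ δ' : ℝ} (h : PrimeTwoFamiliesAt δ) (hδ : δ ≤ δ') :
    PrimeTwoFamiliesAt δ' := by
  intro n₀
  obtain ⟨n, hn, p, hp, A, B, hW, hX, hpn, hAB⟩ := h (n₀ + 1)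
  have hn1 : (1 : ℝ) ≤ n := by exact_mod_cast (show 1 ≤ n by omega)
  refine ⟨n, by omega, p, hp, A, B, hW, hX, ?_, fun i => ?_⟩
  · exact hpn.trans (Real.rpow_le_rpow_of_exponent_le hn1 (by linarith))
  · exact (Real.rpow_le_rpow_of_exponent_le hn1 (by linarith)).trans (hAB i)

/-- The far slice `δ = 2` holds trivially (singletons `A_i = B_i = {i}` in `ℤ/p`, `n = p`):
the content of the crux is the limit `δ → 0`, not any fixed slice. -/
theorem primeTwoFamiliesAt_two : PrimeTwoFamiliesAt 2 := by
  intro n₀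
  obtain ⟨p, hn₀p, hp⟩ := Nat.exists_infinite_primes (n₀ + 2)
  haveI : Fact p.Prime := ⟨hp⟩
  refine ⟨p, by omega, p, hp, fun i => {((i : ℕ) : ZMod p)}, fun i => {((i : ℕ) : ZMod p)},
    ?_, ?_, ?_, ?_⟩
  · intro i a ha a' ha' b hb b' hb' _
    rw [mem_singleton] at ha ha' hb hb'
    exact ⟨ha.trans ha'.symm, hb.trans hb'.symm⟩
  · intro i j k a ha a' ha' b hb b' hb' h0
    rw [mem_singleton] at ha ha' hb hb'
    subst ha ha' hb hb'
    have h1 : ((i : ℕ) : ZMod p) = ((k : ℕ) : ZMod p) := by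
      have : ((i : ℕ) : ZMod p) - ((k : ℕ) : ZMod p) = 0 := by
        rw [← h0]; abel
      exact sub_eq_zero.1 this
    rw [ZMod.natCast_eq_natCast_iff'] at h1
    rw [Nat.mod_eq_of_lt i.isLt, Nat.mod_eq_of_lt k.isLt] at h1
    exact Fin.ext h1
  · have hp1 : (1 : ℝ) ≤ p := by exact_mod_cast hp.one_lt.le
    calc (p : ℝ) = (p : ℝ) ^ (1 : ℝ) := (Real.rpow_one _).symm
      _ ≤ (p : ℝ) ^ (2 + (2 : ℝ)) := Real.rpow_le_rpow_of_exponent_le hp1 (by norm_num)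
  · intro i
    simp only [card_singleton, sub_self, Real.rpow_zero]
    norm_num

/-! ## §1 Tightness of the `δ`-slack -/

/-- **The exact slice `δ = 0` is false.**  A witness would have `n² ≤ |A_i||B_i| ≤ p ≤ n²` ((W)
makes `(a,b) ↦ a+b` injective on `A_i × B_i`, CKSU Prop. 4.6 `α ≤ β`, tree
`card_mul_card_le_of_dpp`), so the prime `p` would be the square `n²`, `n ≥ 2`. -/
theorem not_primeTwoFamiliesAt_zero : ¬ PrimeTwoFamiliesAt 0 := by
  intro h
  obtain ⟨n, hn, p, hp, A, B, hW, hX, hpn, hAB⟩ := h 2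
  haveI : Fact p.Prime := ⟨hp⟩
  have i : Fin n := ⟨0, by omega⟩
  have h1 : (A i).card * (B i).card ≤ p := by
    have := card_mul_card_le_of_dpp (H := ZMod p) (hW i)
    rwa [ZMod.card] at this
  have h2 : (n : ℝ) ^ (2 - (0 : ℝ)) = (n : ℝ) ^ 2 := by rw [sub_zero, Real.rpow_two]
  have h3 : (n : ℝ) ^ (2 + (0 : ℝ)) = (n : ℝ) ^ 2 := by rw [add_zero, Real.rpow_two]
  have h4 := hAB i
  rw [h2] at h4
  rw [h3] at hpn
  have h5 : (((A i).card * (B i).card : ℕ) : ℝ) ≤ (p : ℝ) := by exact_mod_cast h1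
  have h6 : (p : ℝ) = (n : ℝ) ^ 2 := le_antisymm hpn (h4.trans h5)
  have h7 : p = n ^ 2 := by exact_mod_cast h6
  have hdvd : n ∣ p := ⟨n, by rw [h7]; ring⟩
  rcases (Nat.dvd_prime hp).1 hdvd with h8 | h8
  · omega
  · subst h8
    have : n * n ≤ n * 1 := by nlinarith [h7]
    have := Nat.le_of_mul_le_mul_left this (by omega)
    omega

end Summit.MatrixMultiplication.MatrixMultiplication.Theorems.PrimeTwoFamilies.Negative
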